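import Summits.RiemannHypothesis.RiemannHypothesis.Theorems.ScrewChristoffelBound
import HarnessLib

/-!
# The Christoffel law of the screw Gram chain, II: finitely many zeros at once and the ROTATED (2×2-block) bound (EM-3b; column DBR)

LINE 1 — LABEL: `sq_dotProduct_rot_le` is RH-FREE (Cauchy–Schwarz in `ℝ²`); the two bounds are RH-CONSEQUENCES (binder
`RiemannHypothesis →` never dropped). bears_on: LADDER-RH B-D → B-P (cell rh-dbr, seat rh-dbr-eng-5 «E_M from H_M»; sequel of
`Theorems.ScrewChristoffelBound` = EM-3: D-0040 rung 3 for this seat's EM-1/EM-2 Christoffel table). WHAT THIS IS NOT: progress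
toward RH; these are readings of Suzuki's explicit formula (1.9) through the Gram chain; a certified instance at finite `M` is an
RH-consequence CHECK, never evidence for RH.

* `finsetZero_bound_of_riemannHypothesis` — RH ⟹ for every FINITE set `F` of non-trivial zeros and every finite real
  configuration, `Σ_{ρ∈F} (m_ρ/(Im ρ)²)|Σ_j x_j(e^{i Im(ρ)t_j} − 1)|² ≤ Σ_{ij} G(t_i,t_j) x_i x_j` (the Gram form dominates any
  finite part of the zero series; `F = {ρ₀, ρ̄₀}` is EM-3's one-zero bound).
* `rot_dotProduct_inv_le_of_riemannHypothesis` — RH ⟹ for `S_M ≻ 0` and every angle `θ`, with `w = cos θ·c + sin θ·s`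
  (`c_i = cos(γ₀ log(i+2)) − 1`, `s_i = sin(γ₀ log(i+2))`): `wᵀS_M⁻¹w ≤ γ₀²/(2m(ρ₀))`, i.e. the `2×2` Christoffel block
  `[[cᵀS⁻¹c, cᵀS⁻¹s],[sᵀS⁻¹c, sᵀS⁻¹s]] ⪯ (γ₀²/2m(ρ₀))·I₂` — the sharpest RH-consequence at this level: it implies EM-3's
  diagonal bounds and `λ_M(γ₀) ≥ m(ρ₀)`, and predicts (with EM-1's `λ_M(γ_k) → 1⁺`) that BOTH block eigenvalues saturate at
  `γ_k²/2` and the cross term `cᵀS_M⁻¹s → 0` as `M → ∞` (proposed DATA question EM-3/Q9 on the cell's STATUS; not run here).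

References: M. Suzuki, J. Lond. Math. Soc. (2) 108 (2023) = arXiv:2206.03682, (1.9), Thm 1.2; P. Nevai, «Géza Freud, orthogonal
polynomials and Christoffel functions», J. Approx. Theory 48 (1986) §4.
-/

-- `Summit.RiemannHypothesis.RiemannHypothesis.…` duplicates `RiemannHypothesis` BY DESIGN (D-0017).
set_option linter.dupNamespace false

noncomputable section

namespace Summit.RiemannHypothesis.RiemannHypothesis.Theorems.ScrewChristoffel

open Complex Finset Matrix
open scoped BigOperators ComplexConjugate
open Literature.NumberTheory.LFunctions Literature.NumberTheory.LFunctions.ZetaZeros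
open Summit.RiemannHypothesis.RiemannHypothesis.Theorems.IntegerScrew

variable {N : ℕ}

/-! ## §5 Finitely many zeros at once, and the ROTATED (2×2-block) Christoffel bound -/

/-- **RH ⟹ the Gram form dominates ANY FINITE PART of the zero series**: for every finite set `F` of non-trivial zeros and
every finite real configuration, `Σ_{ρ ∈ F} (m_ρ/(Im ρ)²)|Σ_j x_j(e^{i Im(ρ) t_j} − 1)|² ≤ Σ_{ij} G(t_i,t_j) x_i x_j` (take `F ∋ ρ, ρ̄`
to recover the factor `2` of `oneZero_bound_of_riemannHypothesis`). RH-CONSEQUENCE. [cite: Suzuki2023, (1.9) and Thm 1.2] -/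
theorem finsetZero_bound_of_riemannHypothesis (hRH : _root_.RiemannHypothesis) (F : Finset riemannZetaNontrivialZeros)
    (t x : Fin N → ℝ) :
    ∑ ρ ∈ F, (riemannZetaZeroOrder (ρ : ℂ) : ℝ) / (ρ : ℂ).im ^ 2 *
        ‖∑ j, (x j : ℂ) * (cexp (I * ((ρ : ℂ).im : ℂ) * (t j : ℝ)) - 1)‖ ^ 2 ≤
      ∑ i, ∑ j, zetaScrewKernel (t i) (t j) * (x i * x j) := by
  set r : riemannZetaNontrivialZeros → ℝ := fun ρ => (riemannZetaZeroOrder (ρ : ℂ) : ℝ) / (ρ : ℂ).im ^ 2 *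
    ‖∑ j, (x j : ℂ) * (cexp (I * ((-(ρ : ℂ).im : ℝ) : ℂ) * (t j : ℝ)) - 1)‖ ^ 2 with hr
  have hsum : HasSum r (∑ i, ∑ j, zetaScrewKernel (t i) (t j) * (x i * x j)) := by
    have h := hasSum_quadForm t x
    simp only [quadTerm_eq_of_riemannHypothesis hRH] at h
    exact Complex.hasSum_ofReal.1 h
  have hr0 : ∀ ρ, 0 ≤ r ρ := fun ρ => by
    have hm0 : (0 : ℝ) ≤ riemannZetaZeroOrder (ρ : ℂ) := ZetaZeroSum.zeroOrder_nonneg ρ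
    positivity
  have h2 := sum_le_hasSum F (fun ρ _ => hr0 ρ) hsum
  refine le_trans (le_of_eq (sum_congr rfl fun ρ _ => ?_)) h2
  simp only [hr]
  rw [norm_sum_cexp_neg]

/-- RH-FREE: rotating the pair `(c, s)` — for `w = cos θ · c + sin θ · s`, `(y·w)² ≤ (y·c)² + (y·s)²` (Cauchy–Schwarz in `ℝ²`).
[folklore] -/
theorem sq_dotProduct_rot_le {n : Type*} [Fintype n] (θ : ℝ) (y c s : n → ℝ) :
    (y ⬝ᵥ (fun i => Real.cos θ * c i + Real.sin θ * s i)) ^ 2 ≤ (y ⬝ᵥ c) ^ 2 + (y ⬝ᵥ s) ^ 2 := by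
  have e : y ⬝ᵥ (fun i => Real.cos θ * c i + Real.sin θ * s i) = Real.cos θ * (y ⬝ᵥ c) + Real.sin θ * (y ⬝ᵥ s) := by
    simp only [dotProduct, mul_sum, sum_add_distrib.symm]
    exact sum_congr rfl fun i _ => by ring
  rw [e]
  nlinarith [Real.cos_sq_add_sin_sq θ, sq_nonneg (Real.cos θ * (y ⬝ᵥ s) - Real.sin θ * (y ⬝ᵥ c))]

variable (n : ℕ)

/-- **THE ROTATED CHRISTOFFEL LAW under RH (2×2-block form)**: for every angle `θ`, with `w = cos θ · c + sin θ · s`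
(`c_i = cos(γ₀ log(i+2)) − 1`, `s_i = sin(γ₀ log(i+2))`), `wᵀ S_M⁻¹ w ≤ γ₀²/(2 m(ρ₀))` — i.e. the `2 × 2` Christoffel block
`[[cᵀS⁻¹c, cᵀS⁻¹s],[sᵀS⁻¹c, sᵀS⁻¹s]] ⪯ (γ₀²/2m(ρ₀))·I₂`, the sharpest RH-consequence at this level (it implies both diagonal bounds
and `λ_M(γ₀) ≥ m(ρ₀)`). For `S_M ≻ 0` (an RH-consequence; a kernel theorem for `M ≤ 128`). RH-CONSEQUENCE.
[cite: Suzuki2023, (1.9) and Thm 1.2] -/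
theorem rot_dotProduct_inv_le_of_riemannHypothesis (hRH : _root_.RiemannHypothesis) (hS : (screwMatrix n).PosDef)
    (ρ₀ : riemannZetaNontrivialZeros) (θ : ℝ) :
    (fun i : Fin n => Real.cos θ * (Real.cos ((ρ₀ : ℂ).im * Real.log (((i : ℕ) + 2 : ℕ) : ℝ)) - 1) +
        Real.sin θ * Real.sin ((ρ₀ : ℂ).im * Real.log (((i : ℕ) + 2 : ℕ) : ℝ))) ⬝ᵥ
      ((screwMatrix n)⁻¹ *ᵥ fun i : Fin n => Real.cos θ * (Real.cos ((ρ₀ : ℂ).im * Real.log (((i : ℕ) + 2 : ℕ) : ℝ)) - 1) +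
        Real.sin θ * Real.sin ((ρ₀ : ℂ).im * Real.log (((i : ℕ) + 2 : ℕ) : ℝ))) ≤
      (ρ₀ : ℂ).im ^ 2 / (2 * (riemannZetaZeroOrder (ρ₀ : ℂ) : ℝ)) := by
  have hm : (1 : ℝ) ≤ riemannZetaZeroOrder (ρ₀ : ℂ) := by
    exact_mod_cast riemannZetaNontrivialZeros.one_le_order ρ₀.2
  have hγ : (ρ₀ : ℂ).im ≠ 0 := riemannZetaNontrivialZeros.im_ne_zero ρ₀.2
  have hm0 : (0 : ℝ) < riemannZetaZeroOrder (ρ₀ : ℂ) := by linarith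
  have hα : 0 < 2 * (riemannZetaZeroOrder (ρ₀ : ℂ) : ℝ) / (ρ₀ : ℂ).im ^ 2 := by positivity
  have h := dotProduct_inv_mulVec_le hS hα
    (fun i : Fin n => Real.cos θ * (Real.cos ((ρ₀ : ℂ).im * Real.log (((i : ℕ) + 2 : ℕ) : ℝ)) - 1) +
        Real.sin θ * Real.sin ((ρ₀ : ℂ).im * Real.log (((i : ℕ) + 2 : ℕ) : ℝ))) fun y => ?_
  · rw [one_div, inv_div] at h
    exact h
  · refine le_trans ?_ (screwMatrix_oneZero_bound_of_riemannHypothesis n hRH ρ₀ y)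
    have hcs := sq_dotProduct_rot_le θ y
      (fun i : Fin n => Real.cos ((ρ₀ : ℂ).im * Real.log (((i : ℕ) + 2 : ℕ) : ℝ)) - 1)
      (fun i : Fin n => Real.sin ((ρ₀ : ℂ).im * Real.log (((i : ℕ) + 2 : ℕ) : ℝ)))
    have e1 : y ⬝ᵥ (fun i : Fin n => Real.cos ((ρ₀ : ℂ).im * Real.log (((i : ℕ) + 2 : ℕ) : ℝ)) - 1) =
        ∑ i : Fin n, y i * (Real.cos ((ρ₀ : ℂ).im * Real.log (((i : ℕ) + 2 : ℕ) : ℝ)) - 1) := rfl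
    have e2 : y ⬝ᵥ (fun i : Fin n => Real.sin ((ρ₀ : ℂ).im * Real.log (((i : ℕ) + 2 : ℕ) : ℝ))) =
        ∑ i : Fin n, y i * Real.sin ((ρ₀ : ℂ).im * Real.log (((i : ℕ) + 2 : ℕ) : ℝ)) := rfl
    rw [e1, e2] at hcs
    exact le_trans (mul_le_mul_of_nonneg_left hcs hα.le) le_rfl

end Summit.RiemannHypothesis.RiemannHypothesis.Theorems.ScrewChristoffel

end
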